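import Summits.AtomisticToContinuum.BoseEinsteinCondensation.Theorems.BoxCountShadowOwnCountObjects
import HarnessLib

/-!
# BoxCountShadowOwnCount — lens-6 carving #5 (gen 37): the global residual NUM_h carved ALONG THE RANGE AXIS,
# and its bounded-scale half discharged by the energy class

Cell `decomp-a2c`, lens 6 «barrier-complement carving», conjunct `BoseEinsteinCondensation`, box line
(stmt-AtomisticToContinuum-27506).  Continuation of `BoxCountShadow*` (same namespace; imports the landed
`BoxCountShadowCountParity`).  Target of this generation = the declared residual of record,
`GroundStateHorizonCountAffinity η` (NUM_h(η): insertion tolerance of the horizon count law; critic rows 528/538/540: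
GLOBAL · IDEA-NEEDED; the accepted witness family — ancestor-parity locks at K-dependently many scales — shows that NO
argument using finitely many bounded scales reaches it).

THE NEW AXIS (range of conditional dependence).  Every witness against NUM_h in the cell's books (sibling / ancestor /
sublattice parity locks, at any scale `≥ 1` cell) has ONE signature: the conditional law of the inserted particle's
cell GIVEN THE WHOLE COUNT FIELD `m` differs, in `L¹(P̄)`, from its conditional law GIVEN THAT CELL'S OWN COUNT `m_B`
— the insertion law has RANGE `> 0` on the count lattice.  Conversely the number-locked (Mott) state has range `0`
but no unit-step regularity.  Gen 37 carves NUM_h along exactly this line and then shows that the range-0 half is ALL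
that is left outside the energy class:

  NUM_h(η)   ⟸  OCS_h(η) ∧ USR_h(η)              (`horizonCountAffinity_of_ownCount`)
  USR^e_h(η) ⟸  MARG^e_h(η) ⟸ LOC_h(η) ∧ DLT_h(η)  (`unitStepRegularityEven_of_cellCountAffinityEven`, NEW, by a
               Cauchy–Schwarz split of the one-cell count affinity; MARG^e_h ⟸ LOC_h ∧ DLT_h and DLT_h are the TREE's
               `horizonCellCountAffinityEven_of_loc`, `CoercivityLine.densityLLNTrunc_holds`)
  NUM_h(η)   ⟸  LOC_h(η) ∧ OCS_h(η)               (`horizonCountAffinity_of_loc_ownCount`, via NUM^e_h and the tree's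
               parity lift `horizonCountAffinity_of_even`)
  BEC        ⟸  UGS ∧ LOC_h(η) ∧ OCS_h(η) ∧ SUF_h(η)   (`bec_of_loc_ownCount₀`, 0 sorry; LOC_h, SUF_h, UGS are the
               record's other pieces, unchanged)

so MODULO THE ENERGY-CLASS PIECE LOC_h(η) THE GLOBAL RESIDUAL NUM_h(η) (equivalently CSUF_h(η),
`horizonCountSufficiency_iff_countAffinity_of_loc`) IS IMPLIED BY ONE STATEMENT OF A NEW TYPE:

* OCS_h(η) `GroundStateHorizonOwnCountSufficiency η` (crux · DECLARED RESIDUAL of gen 37 · GLOBAL · NEW TYPE =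
  conditional independence / range-0 Markov property of the insertion law on the horizon count lattice ·
  UNDECIDED-with-test · TRUE at the Ornstein–Zernike (Bogoliubov) level with an explicit rate): `ownCountDefect → 0`,
  i.e. `Σ_m Σ_B |Q(B,m) − P̄(m)·Q_B(m_B)/P̄_B(m_B)| → 0` — «the cell of the inserted particle is conditionally
  independent of the other cells' counts GIVEN ITS OWN CELL'S COUNT», in `P̄`-averaged total variation, at every block
  number of every sufficiently coarse horizon window (for each fixed horizon constant `M ≥ M₀`, as `ρ → 0`, `N → ∞`);
* USR_h(η) `GroundStateHorizonUnitStepRegularity η` (support · LOCAL (one cell) · bounded-scale · its even-`K` form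
  USR^e_h PROVED here from LOC_h(η)): off a set of (cell, own-count) pairs of `P̄_B`-mass `≤ δK³`, `δ < 1`, the one-cell
  insertion ratio `Q_B(j)/P̄_B(j) = P(x₁ ∈ B | n_B = j)` is `≥ κK⁻³` — typical-`j` UNIT-STEP REGULARITY
  `(j+1)p_B(j+1) ≳ κλ p_B(j)` of ONE cell's occupation law.

KERNEL A (pointwise trichotomy per `(m,B)`, then two summations; no chaining across cells, hence no `c^K` loss):
`(t/2)^{1/2} ≤ countAffinity + (t/2)^{1/2}·(K⁻³·badMass_t + (2/t)·ownCountDefect)` (`countAffinity_ge_of_ownCount`).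
KERNEL B (Cauchy–Schwarz split good/bad of the one-cell count affinity):
`cellCountAffinity ≤ (K⁻³·goodMass_t)^{1/2} + t^{1/2}`, `K⁻³(goodMass_t + badMass_t) = 1`
(`cellCountAffinity_le_of_unitStep`, `goodMass_add_badMass`), whence MARG ⟹ USR with `κ = c²/4`, `δ = 1 − c²/4`.

WHY OCS_h IS NOT NUM_h RENAMED (model states, module-docstring level; must-fail probes in `bc/`): number-locked (Mott)
state at the horizon scale: OCS_h holds (defect `= 0`), NUM_h, MARG_h, LOC_h fail; pair/ancestor-parity-locked states
Ψ_s (every `s ≥ 0`): LOC_h, MARG_h, USR_h hold, OCS_h fails (defect `≈ 2`), NUM_h fails; half-locked mixtures: NUM_h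
holds (`c ≈ 1/2`), OCS_h fails — so OCS_h is INCOMPARABLE with NUM_h (an `o(1)` conditional-independence statement
vs. an `Ω(1)` affinity floor; the kernel consumes OCS_h at the single tolerance `ε = κ(1−δ)/4` fixed by the MARG^e
constants, so a fixed-tolerance form would do), sufficient for it modulo LOC_h, and its witnesses are EXACTLY the
multi-cell locks — the complement of the bounded-scale witness mechanism of rows 528/538, not reachable by any finite
set of scales.  Why TRUE-type: for a Gaussian count field with cell covariance `C = λŜ` the range-`>0` part of the
log insertion rate `ln r_B(m) = −Σ_{B'}(C⁻¹)_{BB'}(m_{B'} − λ) + (own-count term)` has variance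
`(h/λ)(h s₀ − 1)`, `h = K⁻³Σ_q 1/Ŝ(q)`, `s₀ = K⁻³Σ_q Ŝ(q)`; in the phonon regime `Ŝ(q) ≈ |q|ξ` (all horizon-lattice
modes, `ℓ_h ≫ ξ`) one gets `h s₀ − 1 = O(1)` and `h/λ ≍ (ρ ξ ℓ_h²)⁻¹ ≍ (8πa)^{1/2} ρ^{1/2+2η}/M² → 0` — so the defect
vanishes at the OZ/Bogoliubov level at rate `ρ^{1/4+η}/M` for every `η ≥ 0`, resting on the linear infrared behaviour
of `S` (f-sum + compressibility sum rules; the floor `S(k) ≥ c·min(ℓ|k|,1)` is the tree item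
`BECPalmDirectCorrelation.StructureFactorFloor`, stmt-AtomisticToContinuum-12228); the content of OCS_h beyond print
is the NON-Gaussian conditional independence — a statement of Gibbsian / global-Markov type for the `t = 0` slice of
the Feynman–Kac measure of the interacting gas.

No instances, no notation, no sorry; imports = part 1 `BoxCountShadowOwnCountObjects` (objects + Kernels A/B,
landing split for the 400-line rule) + HarnessLib.
-/

open MeasureTheory Filter Set
open scoped ENNReal NNReal BigOperators

namespace Summit.AtomisticToContinuum.BoseEinsteinCondensation.Theorems.BoxCountShadow

open Literature.MathematicalPhysics.QuantumManyBody.BoseGas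
open Summit.AtomisticToContinuum.BoseEinsteinCondensation.Theorems.BoxLatticeFSum
open Summit.AtomisticToContinuum.BoseEinsteinCondensation.Theorems.BoxLabelAffinity
open Summit.AtomisticToContinuum.BoseEinsteinCondensation.Theorems.BoxHorizonAffinity

variable {n : ℕ}

/-- `(a²)^{1/2} = a` in `ℝ≥0∞` (private copy; the tree has it as
`Literature.Barriers.AnomalousDissipation.ennreal_sq_rpow_half`). [folklore] -/
private theorem sq_rpow_half_eq (a : ℝ≥0∞) : (a ^ 2) ^ (1 / 2 : ℝ) = a := by
  rw [← ENNReal.rpow_two, ← ENNReal.rpow_mul]; norm_num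

/-- `(a^{1/2})² = a` in `ℝ≥0∞` (private copy; the tree has it as `ENNReal.rpow_half_sq`). [folklore] -/
private theorem rpow_half_pow_two (a : ℝ≥0∞) : (a ^ (1 / 2 : ℝ)) ^ 2 = a := by
  rw [← ENNReal.rpow_two, ← ENNReal.rpow_mul]; norm_num


/-! ### §7.5  The pieces -/

/-- **OCS_h(η)** (crux · DECLARED RESIDUAL of gen 37 · GLOBAL · NEW TYPE: conditional independence / range-0 Markov
property of the insertion law on the horizon count lattice · UNDECIDED-with-test · TRUE at the Ornstein–Zernike
level · INCOMPARABLE with the target NUM_h (holds in the number-locked Mott state where NUM_h fails; fails in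
half-locked mixtures where NUM_h holds) and SUFFICIENT for it modulo the energy-class piece LOC_h(η)
(`horizonCountAffinity_of_loc_ownCount`)) `GroundStateHorizonOwnCountSufficiency η`: for `a > 0` there is `M₀`
such that for every horizon constant `M ≥ M₀` and every `ε > 0`, below a density cap and eventually in `N`, the
nonnegative ground state has `ownCountDefect ≤ ε` at every block number of the horizon window: in `P̄`-averaged
total variation, THE CELL OF THE INSERTED PARTICLE IS CONDITIONALLY INDEPENDENT OF THE OTHER CELLS' COUNTS GIVEN ITS
OWN CELL'S COUNT — the own count is an asymptotically SUFFICIENT statistic of the whole count field for insertion.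
TEST (what kills it): every parity / commensuration lock involving `≥ 2` horizon cells at ANY scale (sibling,
ancestor, sublattice; the witness family of critic row 538) gives defect `≈ 2·(locked mass)`; so OCS_h is EXACTLY
the complement of the bounded-scale witness mechanism, and it is not reachable by any finite set of scales.  The
kernel consumes it only at the fixed tolerance `ε = κ(1−δ)/4` determined by the MARG^e_h constants.  Why TRUE-type:
for a Gaussian count field with cell covariance `λŜ` the range-`>0` part of the log insertion rate has variance
`(h/λ)(h s₀ − 1)`, `h = K⁻³Σ_q Ŝ(q)⁻¹`, `s₀ = K⁻³Σ_q Ŝ(q)`; with `Ŝ(q) ≈ |q|ξ` on the horizon lattice (`ℓ_h ≫ ξ`)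
this is `≍ (ρξℓ_h²)⁻¹ ≍ (8πa)^{1/2}ρ^{1/2+2η}/M² → 0` for every fixed `M` (f-sum + compressibility sum rules; IR
floor of `S`: tree item `BECPalmDirectCorrelation.StructureFactorFloor`, stmt-AtomisticToContinuum-12228); the
content beyond print is NON-Gaussian conditional independence (Gibbsianness / global Markov property of the `t = 0`
slice of the Feynman–Kac measure; nearest print: Dobrushin–Shlosman complete analyticity ⇒ GMP for lattice systems,
canonical-DLR number tolerance of Gibbs point processes [DereudreVasseur2023], product measures conditioned on cell
counts = products of canonical measures [KipnisLandim1999, App. 2]), not available for `|Ψ₀|²` of interacting bosons.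
Why it might fail: only through a genuinely multi-cell arithmetic constraint in `|Ψ₀|²` (a hidden sublattice or
ancestor order of horizon counts), which no energy functional at precision `o(N/L²)` excludes (route
`NumberFilterBlindness`).
[cite: DereudreVasseur2023, canonical DLR ⇒ number tolerance] [cite: GhoshPeres2017, rigidity–tolerance]
[cite: KipnisLandim1999, App. 2 (equivalence of ensembles)] [cite: Stringari1995, (7),(20)–(22) (sum rules)] -/
@[conjecture] def GroundStateHorizonOwnCountSufficiency (η : ℝ≥0) : Prop :=
  ∀ v : ℝ → ℝ≥0∞, IsRepulsiveFiniteRange v → 0 < scatteringLength v →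
    ∃ M₀ : ℝ, 0 < M₀ ∧ ∀ M : ℝ, M₀ ≤ M → ∀ ε : ℝ, 0 < ε → ∃ ρ₀ : ℝ, 0 < ρ₀ ∧ ∀ ρ : ℝ, 0 < ρ → ρ < ρ₀ →
      ∀ᶠ n : ℕ in atTop,
        (∃ Ψ₀ : Config (n + 1) → ℝ, (∀ X, 0 ≤ Ψ₀ X) ∧
          IsGroundState v (sideLength ρ (n + 1)) (fun X => (Ψ₀ X : ℂ))) →
        ∀ K : ℕ, 0 < K → InWindow (M * ρ ^ (-(η : ℝ))) ρ (sideLength ρ (n + 1)) K →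
          ownCountDefect (sideLength ρ (n + 1)) K (groundState v (n + 1) (sideLength ρ (n + 1))) ≤
            ENNReal.ofReal ε

/-- **USR_h(η)** (support · LOCAL (one horizon cell at a time) · bounded-scale class · its even-`K` form is PROVED
below from LOC_h(η) · TRUE-type) `GroundStateHorizonUnitStepRegularity η`: for `a > 0` there is `M₀` such that for
every `M ≥ M₀` there are `κ > 0`, `δ ∈ [0,1)` with, below a density cap and eventually in `N`, at every block number
of the horizon window, `K⁻³·unitStepBadMass (ofReal κ) ≤ δ`: off a set of (cell, own-count) pairs of normalised
`P̄_B`-mass `≤ δ`, the one-cell insertion ratio satisfies `P(x₁ ∈ B | n_B = j) ≥ κK⁻³`, i.e.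
`(j+1)p_B(j+1) ≳ κλ·p_B(j)` for `p_B`-typical `j` — UNIT-STEP REGULARITY OF ONE CELL'S OCCUPATION LAW.  Equivalent in
type to the one-cell count affinity MARG_h (`unitStepRegularityEven_of_cellCountAffinityEven` and, conversely, Kernel A
with defect `0` cell by cell).  Holds in every multi-cell parity-locked witness state, fails in the Mott state.  Why it
might fail: only through unit-scale locking of a single horizon cell's occupation number, excluded at even `K` by
parent-scale condensation LOC_h(η). [cite: LSSY2005, Thm 7.1 (GP-box BEC regime)] [cite: GhoshPeres2017, rigidity–tolerance] -/
@[conjecture] def GroundStateHorizonUnitStepRegularity (η : ℝ≥0) : Prop :=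
  ∀ v : ℝ → ℝ≥0∞, IsRepulsiveFiniteRange v → 0 < scatteringLength v →
    ∃ M₀ : ℝ, 0 < M₀ ∧ ∀ M : ℝ, M₀ ≤ M → ∃ κ : ℝ, 0 < κ ∧ ∃ δ : ℝ, 0 ≤ δ ∧ δ < 1 ∧
      ∃ ρ₀ : ℝ, 0 < ρ₀ ∧ ∀ ρ : ℝ, 0 < ρ → ρ < ρ₀ →
        ∀ᶠ n : ℕ in atTop,
          (∃ Ψ₀ : Config (n + 1) → ℝ, (∀ X, 0 ≤ Ψ₀ X) ∧
            IsGroundState v (sideLength ρ (n + 1)) (fun X => (Ψ₀ X : ℂ))) →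
          ∀ K : ℕ, 0 < K → InWindow (M * ρ ^ (-(η : ℝ))) ρ (sideLength ρ (n + 1)) K →
            blockWeight K ^ 2 *
                unitStepBadMass (sideLength ρ (n + 1)) K (groundState v (n + 1) (sideLength ρ (n + 1)))
                  (ENNReal.ofReal κ) ≤
              ENNReal.ofReal δ

/-- **USR^e_h(η)**: `GroundStateHorizonUnitStepRegularity η` demanded only at EVEN block numbers `K` of the window.
PROVED below from LOC_h(η) (`unitStepRegularityEven_of_loc`, through the tree's MARG^e_h ⟸ LOC_h ∧ DLT_h and DLT_h).
Why it might fail: only if LOC_h(η) fails. [cite: LSSY2005, Thm 7.1 (GP-box BEC regime)] -/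
@[conjecture] def GroundStateHorizonUnitStepRegularityEven (η : ℝ≥0) : Prop :=
  ∀ v : ℝ → ℝ≥0∞, IsRepulsiveFiniteRange v → 0 < scatteringLength v →
    ∃ M₀ : ℝ, 0 < M₀ ∧ ∀ M : ℝ, M₀ ≤ M → ∃ κ : ℝ, 0 < κ ∧ ∃ δ : ℝ, 0 ≤ δ ∧ δ < 1 ∧
      ∃ ρ₀ : ℝ, 0 < ρ₀ ∧ ∀ ρ : ℝ, 0 < ρ → ρ < ρ₀ →
        ∀ᶠ n : ℕ in atTop,
          (∃ Ψ₀ : Config (n + 1) → ℝ, (∀ X, 0 ≤ Ψ₀ X) ∧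
            IsGroundState v (sideLength ρ (n + 1)) (fun X => (Ψ₀ X : ℂ))) →
          ∀ K : ℕ, 0 < K → Even K → InWindow (M * ρ ^ (-(η : ℝ))) ρ (sideLength ρ (n + 1)) K →
            blockWeight K ^ 2 *
                unitStepBadMass (sideLength ρ (n + 1)) K (groundState v (n + 1) (sideLength ρ (n + 1)))
                  (ENNReal.ofReal κ) ≤
              ENNReal.ofReal δ

/-- USR_h(η) ⟹ USR^e_h(η) (forget the parity restriction). [folklore] -/
theorem unitStepRegularityEven_of_unitStep (η : ℝ≥0) (h : GroundStateHorizonUnitStepRegularity η) :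
    GroundStateHorizonUnitStepRegularityEven η := by
  intro v hv ha
  obtain ⟨M₀, hM₀, hM⟩ := h v hv ha
  refine ⟨M₀, hM₀, fun M hMge => ?_⟩
  obtain ⟨κ, hκ, δ, hδ0, hδ1, ρ₀, hρ₀, h'⟩ := hM M hMge
  refine ⟨κ, hκ, δ, hδ0, hδ1, ρ₀, hρ₀, fun ρ hρ hρlt => ?_⟩
  filter_upwards [h' ρ hρ hρlt] with n hn hex K hK _hKe hKw
  exact hn hex K hK hKw

/-! ### §7.6  The bounded-scale half is in the energy class: MARG^e_h ⟹ USR^e_h, hence LOC_h ⟹ USR^e_h -/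

/-- **MARG^e_h(η) ⟹ USR^e_h(η)** (`κ = c'²/4`, `δ = 1 − c'²/4`, `c' = min(c,1)`; Kernel B at level `t = (c'/2)²`).
[folklore] -/
theorem unitStepRegularityEven_of_cellCountAffinityEven (η : ℝ≥0)
    (h : GroundStateHorizonCellCountAffinityEven η) : GroundStateHorizonUnitStepRegularityEven η := by
  intro v hv ha
  obtain ⟨M₀, hM₀, hM⟩ := h v hv ha
  refine ⟨M₀, hM₀, fun M hMge => ?_⟩
  obtain ⟨c, hc, ρ₀, hρ₀, h'⟩ := hM M hMge
  have hMpos : 0 < M := hM₀.trans_le hMge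
  set c' : ℝ := min c 1 with hc'def
  have hc'0 : 0 < c' := lt_min hc one_pos
  have hc'1 : c' ≤ 1 := min_le_right _ _
  refine ⟨c' ^ 2 / 4, by positivity, 1 - c' ^ 2 / 4, by nlinarith, by nlinarith, ρ₀, hρ₀,
    fun ρ hρ hρlt => ?_⟩
  filter_upwards [h' ρ hρ hρlt] with n hn hex K hK hKe hKw
  set L := sideLength ρ (n + 1) with hLdef
  set Φ := groundState v (n + 1) L with hΦdef
  have hA : 0 < M * ρ ^ (-(η : ℝ)) := mul_pos hMpos (Real.rpow_pos_of_pos hρ _)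
  have hL : 0 < L := sideLength_pos_of_inWindow hA hρ hK hKw
  have hΦm : Measurable Φ := measurable_groundState v (n + 1) L
  have hΦ1 : ∫⁻ Y : Config n, ∫⁻ x, ENNReal.ofReal (Φ (Matrix.vecCons x Y)) ^ 2 = 1 := by
    rw [← lintegral_eq_lintegral_lintegral_vecCons (hΦm.ennreal_ofReal.pow_const 2)]
    exact lintegral_groundState_sq hex
  have hmarg : ENNReal.ofReal c' ≤ cellCountAffinity L K Φ :=
    (ENNReal.ofReal_le_ofReal (min_le_left c 1)).trans (hn hex K hK hKe hKw)
  set s : ℝ≥0∞ := ENNReal.ofReal (c' / 2) with hsdef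
  have hs_top : s ≠ ∞ := ENNReal.ofReal_ne_top
  have hs2_top : s ^ 2 ≠ ∞ := ENNReal.pow_ne_top hs_top
  have ht : ENNReal.ofReal (c' ^ 2 / 4) = s ^ 2 := by
    rw [hsdef, ← ENNReal.ofReal_pow (by positivity)]
    congr 1; ring
  have hB := cellCountAffinity_le_of_unitStep hL hK hΦm hΦ1 (s ^ 2)
  rw [sq_rpow_half_eq] at hB
  set G : ℝ≥0∞ := blockWeight K ^ 2 * unitStepGoodMass L K Φ (s ^ 2) with hGdef
  have hGB := goodMass_add_badMass (L := L) hK hΦ1 (s ^ 2)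
  -- s ≤ G^{1/2}
  have hcs : ENNReal.ofReal c' = s + s := by
    rw [hsdef, ← ENNReal.ofReal_add (by positivity) (by positivity)]
    congr 1; ring
  have h1 : s ≤ G ^ (1 / 2 : ℝ) := by
    have : s + s ≤ G ^ (1 / 2 : ℝ) + s := hcs ▸ hmarg.trans hB
    exact (ENNReal.add_le_add_iff_right hs_top).1 this
  have h2 : s ^ 2 ≤ G := by
    calc s ^ 2 ≤ (G ^ (1 / 2 : ℝ)) ^ 2 := by rw [sq, sq]; exact mul_le_mul' h1 h1
      _ = G := rpow_half_pow_two G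
  have hδ : (1 : ℝ≥0∞) = ENNReal.ofReal (1 - c' ^ 2 / 4) + s ^ 2 := by
    rw [← ht, ← ENNReal.ofReal_add (by nlinarith) (by positivity)]
    rw [show 1 - c' ^ 2 / 4 + c' ^ 2 / 4 = (1 : ℝ) by ring, ENNReal.ofReal_one]
  rw [ht]
  have key : blockWeight K ^ 2 * unitStepBadMass L K Φ (s ^ 2) + s ^ 2 ≤
      ENNReal.ofReal (1 - c' ^ 2 / 4) + s ^ 2 := by
    calc blockWeight K ^ 2 * unitStepBadMass L K Φ (s ^ 2) + s ^ 2
        ≤ blockWeight K ^ 2 * unitStepBadMass L K Φ (s ^ 2) + G := add_le_add le_rfl h2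
      _ = 1 := by rw [add_comm]; exact hGB
      _ = ENNReal.ofReal (1 - c' ^ 2 / 4) + s ^ 2 := hδ
  exact (ENNReal.add_le_add_iff_right hs2_top).1 key

/-- **LOC_h(η) ⟹ USR^e_h(η)** (0 sorry): through the tree's `horizonCellCountAffinityEven_of_loc` (MARG^e_h ⟸ LOC_h ∧
DLT_h) and `CoercivityLine.densityLLNTrunc_holds` (DLT_h).  The bounded-scale half of the gen-37 carving is in the
energy class. [folklore] -/
theorem unitStepRegularityEven_of_loc (η : ℝ≥0) (hloc : GroundStateHorizonCondensation η) :
    GroundStateHorizonUnitStepRegularityEven η :=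
  unitStepRegularityEven_of_cellCountAffinityEven η
    (horizonCellCountAffinityEven_of_loc η hloc (CoercivityLine.densityLLNTrunc_holds η))

/-! ### §7.7  The kernels -/

/-- **OCS_h(η) ∧ USR^e_h(η) ⟹ NUM^e_h(η)** (0 sorry; constant `c = (κ/2)^{1/2}(1−δ)/2`, Markov tolerance
`ε = κ(1−δ)/4`; Kernel A). [folklore] -/
theorem horizonCountAffinityEven_of_ownCount (η : ℝ≥0) (hocs : GroundStateHorizonOwnCountSufficiency η)
    (husr : GroundStateHorizonUnitStepRegularityEven η) : GroundStateHorizonCountAffinityEven η := by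
  intro v hv ha
  obtain ⟨M₁, hM₁, husr'⟩ := husr v hv ha
  obtain ⟨M₂, hM₂, hocs'⟩ := hocs v hv ha
  refine ⟨max M₁ M₂, lt_max_of_lt_left hM₁, fun M hM => ?_⟩
  obtain ⟨κ, hκ, δ, hδ0, hδ1, ρ₁, hρ₁, h1⟩ := husr' M ((le_max_left _ _).trans hM)
  have hε : 0 < κ * (1 - δ) / 4 := by
    have : 0 < 1 - δ := by linarith
    positivity
  obtain ⟨ρ₂, hρ₂, h2⟩ := hocs' M ((le_max_right _ _).trans hM) (κ * (1 - δ) / 4) hε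
  -- the constant, as an `ℝ≥0∞` number
  set t : ℝ≥0∞ := ENNReal.ofReal κ with htdef
  have ht0 : t ≠ 0 := (ENNReal.ofReal_pos.2 hκ).ne'
  have ht : t ≠ ∞ := ENNReal.ofReal_ne_top
  set s : ℝ≥0∞ := (t / 2) ^ (1 / 2 : ℝ) with hsdef
  have hs_top : s ≠ ∞ :=
    ENNReal.rpow_ne_top_of_nonneg (by norm_num) (ENNReal.div_ne_top ht (by norm_num))
  have hs0 : s ≠ 0 := by
    have : 0 < t / 2 := ENNReal.div_pos ht0 (by norm_num)
    exact (ENNReal.rpow_pos_of_nonneg this (by norm_num)).ne'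
  set cE : ℝ≥0∞ := s * ENNReal.ofReal ((1 - δ) / 2) with hcEdef
  have hcE_top : cE ≠ ∞ := ENNReal.mul_ne_top hs_top ENNReal.ofReal_ne_top
  have hcE0 : cE ≠ 0 := by
    refine mul_ne_zero hs0 ?_
    exact (ENNReal.ofReal_pos.2 (by linarith)).ne'
  refine ⟨cE.toReal, ENNReal.toReal_pos hcE0 hcE_top, min ρ₁ ρ₂, lt_min hρ₁ hρ₂, fun ρ hρ hρlt => ?_⟩
  have hr1 : ρ < ρ₁ := hρlt.trans_le (min_le_left _ _)
  have hr2 : ρ < ρ₂ := hρlt.trans_le (min_le_right _ _)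
  filter_upwards [h1 ρ hρ hr1, h2 ρ hρ hr2] with n husn hocn hex K hK hKe hKw
  rw [ENNReal.ofReal_toReal hcE_top]
  set L := sideLength ρ (n + 1) with hLdef
  set Φ := groundState v (n + 1) L with hΦdef
  have hΦm : Measurable Φ := measurable_groundState v (n + 1) L
  have hΦ1 : ∫⁻ Y : Config n, ∫⁻ x, ENNReal.ofReal (Φ (Matrix.vecCons x Y)) ^ 2 = 1 := by
    rw [← lintegral_eq_lintegral_lintegral_vecCons (hΦm.ennreal_ofReal.pow_const 2)]
    exact lintegral_groundState_sq hex
  have main := countAffinity_ge_of_ownCount (L := L) hK hΦ1 ht0 ht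
  have hbad : blockWeight K ^ 2 * unitStepBadMass L K Φ t ≤ ENNReal.ofReal δ := husn hex K hK hKe hKw
  have hdef : ownCountDefect L K Φ ≤ ENNReal.ofReal (κ * (1 - δ) / 4) := hocn hex K hK hKw
  -- (2/t)·ε = (1-δ)/2
  have h2t : (2 / t) * ENNReal.ofReal (κ * (1 - δ) / 4) = ENNReal.ofReal ((1 - δ) / 2) := by
    have h2 : (2 : ℝ≥0∞) / t = ENNReal.ofReal (2 / κ) := by
      rw [ENNReal.ofReal_div_of_pos hκ, htdef]
      norm_num
    rw [h2, ← ENNReal.ofReal_mul (by positivity)]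
    congr 1
    field_simp
    ring
  have hsum : ENNReal.ofReal δ + ENNReal.ofReal ((1 - δ) / 2) = ENNReal.ofReal ((1 + δ) / 2) := by
    rw [← ENNReal.ofReal_add hδ0 (by linarith)]
    congr 1; ring
  have hone : s = s * ENNReal.ofReal ((1 + δ) / 2) + cE := by
    rw [hcEdef, ← mul_add, ← ENNReal.ofReal_add (by linarith) (by linarith)]
    have : (1 + δ) / 2 + (1 - δ) / 2 = 1 := by ring
    rw [this, ENNReal.ofReal_one, mul_one]
  have hfin : s * ENNReal.ofReal ((1 + δ) / 2) ≠ ∞ := ENNReal.mul_ne_top hs_top ENNReal.ofReal_ne_top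
  have key : cE + s * ENNReal.ofReal ((1 + δ) / 2) ≤
      countAffinity L K Φ + s * ENNReal.ofReal ((1 + δ) / 2) := by
    calc cE + s * ENNReal.ofReal ((1 + δ) / 2) = s := by rw [add_comm, ← hone]
      _ ≤ countAffinity L K Φ +
            (s * (blockWeight K ^ 2 * unitStepBadMass L K Φ t) + s * (2 / t) * ownCountDefect L K Φ) := main
      _ ≤ countAffinity L K Φ +
            (s * ENNReal.ofReal δ + s * ((2 / t) * ENNReal.ofReal (κ * (1 - δ) / 4))) := by
          refine add_le_add le_rfl (add_le_add (mul_le_mul' le_rfl hbad) ?_)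
          rw [mul_assoc]
          exact mul_le_mul' le_rfl (mul_le_mul' le_rfl hdef)
      _ = countAffinity L K Φ + s * ENNReal.ofReal ((1 + δ) / 2) := by
          rw [h2t, ← mul_add, hsum]
  exact (ENNReal.add_le_add_iff_right hfin).1 key

/-- **OCS_h(η) ∧ USR_h(η) ⟹ NUM_h(η)** — the gen-37 carving of the target along the range axis (0 sorry; through
the even-`K` kernel and the tree's parity lift `horizonCountAffinity_of_even`). [folklore] -/
theorem horizonCountAffinity_of_ownCount (η : ℝ≥0) (hocs : GroundStateHorizonOwnCountSufficiency η)
    (husr : GroundStateHorizonUnitStepRegularity η) : GroundStateHorizonCountAffinity η :=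
  horizonCountAffinity_of_even η
    (horizonCountAffinityEven_of_ownCount η hocs (unitStepRegularityEven_of_unitStep η husr))

/-- **LOC_h(η) ∧ OCS_h(η) ⟹ NUM_h(η)** (0 sorry): MODULO THE ENERGY-CLASS PIECE, THE GLOBAL RESIDUAL OF RECORD IS
IMPLIED BY THE RANGE-0 MARKOV PROPERTY ALONE. [folklore] -/
theorem horizonCountAffinity_of_loc_ownCount (η : ℝ≥0) (hloc : GroundStateHorizonCondensation η)
    (hocs : GroundStateHorizonOwnCountSufficiency η) : GroundStateHorizonCountAffinity η :=
  horizonCountAffinity_of_even η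
    (horizonCountAffinityEven_of_ownCount η hocs (unitStepRegularityEven_of_loc η hloc))

/-- **LOC_h(η) ∧ OCS_h(η) ⟹ CSUF_h(η)** (the other name of the global residual, 0 sorry). [folklore] -/
theorem horizonCellCountSufficiency_of_loc_ownCount (η : ℝ≥0) (hloc : GroundStateHorizonCondensation η)
    (hocs : GroundStateHorizonOwnCountSufficiency η) : GroundStateHorizonCellCountSufficiency η :=
  horizonCellCountSufficiency_of_horizonCountAffinity η (horizonCountAffinity_of_loc_ownCount η hloc hocs)

/-- **DECIDING KERNEL OF GEN 37** (0 sorry; hypotheses = declared pieces of the record with NUM_h replaced by OCS_h):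
UGS → LOC_h(η) → OCS_h(η) → SUF_h(η) → `BoseEinsteinCondensation`, for every `η`. [folklore] -/
theorem bec_of_loc_ownCount₀ (η : ℝ≥0) (hU : BoxGroundStateUniqueness) (hloc : GroundStateHorizonCondensation η)
    (hocs : GroundStateHorizonOwnCountSufficiency η) (hsuf : GroundStateHorizonCountSufficiency η) :
    _root_.BoseEinsteinCondensation :=
  bec_of_countPieces₀ η hU hloc (horizonCountAffinity_of_loc_ownCount η hloc hocs) hsuf

/-- The gen-37 record assembled down to the energy-class leaves (0 sorry):
UGS → LOC → TSD(η) → OCS_h(η) → SUF_h(η) → `BoseEinsteinCondensation`. [folklore] -/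
theorem bec_of_twoScaleOwnCount₀ (η : ℝ≥0) (hU : BoxGroundStateUniqueness)
    (hloc : GroundStateBlockCondensation) (htsd : GroundStateTwoScaleDepletion η)
    (hocs : GroundStateHorizonOwnCountSufficiency η) (hsuf : GroundStateHorizonCountSufficiency η) :
    _root_.BoseEinsteinCondensation :=
  bec_of_loc_ownCount₀ η hU (horizonCondensation_of_loc_twoScale η hloc htsd) hocs hsuf

/-- The v1 kernel kept for the record (all four count pieces explicit, 0 sorry):
UGS → LOC_h(η) → OCS_h(η) → USR_h(η) → SUF_h(η) → `BoseEinsteinCondensation`. [folklore] -/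
theorem bec_of_ownCount₀ (η : ℝ≥0) (hU : BoxGroundStateUniqueness) (hloc : GroundStateHorizonCondensation η)
    (hocs : GroundStateHorizonOwnCountSufficiency η) (husr : GroundStateHorizonUnitStepRegularity η)
    (hsuf : GroundStateHorizonCountSufficiency η) : _root_.BoseEinsteinCondensation :=
  bec_of_countPieces₀ η hU hloc (horizonCountAffinity_of_ownCount η hocs husr) hsuf


end Summit.AtomisticToContinuum.BoseEinsteinCondensation.Theorems.BoxCountShadow
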